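import Literature.NumberTheory.Rogawski1990.ArchCentralLimitJetBoundsOfBootstrap     -- ★ p846633 (F0P3a-p02 (g15), (f1)): `exists_frame_testFunction_orbital_eq_lieOrbital`, `exists_smooth_rhoWeylDelta_angleChart_eq_mul_rootProduct`; brings ★ HCClosure, chambers
import Literature.NumberTheory.Rogawski1990.ArchCentralLimitWallToCorner            -- ★ (F0P3a-p02 (g12)): `mem_closure_chamber_of_le`; brings ★ `convex_chamber`
import Literature.NumberTheory.Rogawski1990.ArchCentralLimitCornerValueInversion      -- ★ (F0P3a-p02): `ArchCentralLimitFormulaRankTwo.of_cornerRegularity_of_wallValues_min`; brings ★ def `ArchCentralLimitCornerRegularity` (p843483)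
import Literature.NumberTheory.Rogawski1990.ArchCentralLimitFormulaOfOppositeSigns    -- ★ p844336 (A-p18): `archCentralLimitFormulaRankTwo_of_ppm`
import Literature.NumberTheory.Rogawski1990.ArchCentralLimitBallExportAdapter         -- ★ p844486 (F0P3a-p02 (g13)): `cornerValue_min_of_core`
import Literature.NumberTheory.Rogawski1990.ArchLimitFormulaNoncompactWallThirdJet    -- ★ p844137 (A-p18): `wall02_cubeLimit`
import Literature.NumberTheory.Rogawski1990.ArchCentralLimitFormulaOfExistsLetter     -- ★ p846458 (this seat): `ArchCentralLimitExists.of_rankTwo`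
import Literature.Geometry.ComplexHyperbolic.UnitBallCentreValueOfRayIdentity         -- ★ p845507 (F0P3a-p02 (g14)): `ballCore_of_rayIdentity`
import Literature.Geometry.ComplexHyperbolic.UnitBallCentreValueRayIdentity           -- ★ p846302: `rayIdentity_of_total`
import Literature.Analysis.Calculus.SmoothExtensionToClosure                          -- ★ `exists_contDiffOn_closure_of_bounded_iteratedFDeriv` (bounded jets of all orders on a convex open set ⇒ `C^∞` on the closure)
import Literature.Analysis.Calculus.WhitneyExtensionProofs                            -- ★ `WhitneyExtensionConvex_holds` + `WhitneyExtensionConvex.exists_contDiffOn_extension` (Whitney 1934 Thm. I on closed convex sets, local form)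
import HarnessLib

/-!
# (A6) FROM HARISH-CHANDRA'S JET BOUNDS: the corner `C³` (indeed `C^∞`) extension of `F_Θ∘chart` on every chamber, from bounded jets of `φ_f = π·Φ_f` of all orders — and the letter
# `(L_{U(2,1)})` from those bounds ALONE (ROAD «A6-IV», the extension shortcut: Whitney's theorem is ★ in the tree; Warner II Thm. 8.4.3.1 ⟹ Thm. 8.5.1.1; Rogawski 1990 §8.4 p. 126)

Topic `NumberTheory/Rogawski1990`; namespace `Literature.NumberTheory.Rogawski1990`.  THEOREMS ONLY (no `def`, no instance, no notation, no axiom, no named fact, no `sorry`).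
Cell `pub/hodgecm-mathlib`, ENGINE T1 (crux H413 = `stmt-HodgeConjecture-24833`); ROAD A (N1 = `stub_ArchCentralLimitU21` ∕ print row #179 (A6)), design of record
`DESIGN-A6-InHouse-v2-ArchitectureIV` 93542b84 (owner F0P3a-p05 (g15); LEAD F0P3a-plan (g12) T11-4); author F0P3a-p09 (g2), 2026-09-01.

THE POINT.  Design v2 §1 replaced the EXTENSION socket (A6) ★ `ArchCentralLimitCornerRegularity` («`F_Θ∘chart_ζ` restricted to a chamber `C_σ` has a `C³` extension to a neighbourhood
of the corner») by the JET-BOUND socket, to avoid an extension theorem, at the price of re-opening the value clause in jet-limit form (brick (f2)).  But the tree HOLDS Whitney's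
extension theorem on closed convex sets with nonempty interior (★ `Literature.Analysis.Calculus.WhitneyExtensionConvex_holds`, local form ★ `WhitneyExtensionConvex.exists_contDiffOn_extension`)
and the extension-to-the-closure lemma for functions with bounded jets of all orders on a convex open set (★ `exists_contDiffOn_closure_of_bounded_iteratedFDeriv`).  Hence, at an
e-pattern frame (`re σ_wα₀, re σ_wα₁ > 0 > re σ_wα₂`):
* §1 **`archCentralLimitCornerRegularity_of_liePhiJetBounds`** — IF for every Haar right-invariant `μ` on `U(2,1)`, every `f ∈ C_c^∞(M₃(ℂ))`, every chamber `σ` and every order `n`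
  the jets `Dⁿ(liePhi μ f)` are bounded on `C_σ ∩ B(0,1∕4)` (the output shape of brick (d2) = Harish-Chandra's Thm. 8.4.3.1, VERBATIM the `hball` binder of ★ (f1′)
  `ArchCentralLimitFormulaRankTwo.of_liePhiJetBounds_of_values`), THEN (A6) `ArchCentralLimitCornerRegularity L α w` holds: by ★ (f1) §3 `F_Θ∘chart_ζ = u · liePhi (ν.map e) f` on
  `s = C_σ ∩ B(0,1∕4)` with `u` smooth; `liePhi (ν.map e) f` is `C^∞` on the open convex `s` (★ `contDiffAt_liePhi`) with all jets bounded, so it is `C^∞` on `closure s ∋ 0` (★ closure lemma)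
  and extends to a `C^∞` function `g` on a neighbourhood `O′ ∋ 0` (★ Whitney); `H = u·g` on `U = O′ ∩ B(0,1∕4)` is the required extension.
* §2 **`archCentralLimitFormulaRankTwo_of_liePhiJetBounds`** — THE LETTER at EVERY frame from `hball` ALONE: the «SdArch» ED. 5 body VERBATIM with `stub_A6` replaced by §1
  (★ `archCentralLimitFormulaRankTwo_of_ppm` ∘ ★ `of_cornerRegularity_of_wallValues_min` with the ★ values `cornerValue_min_of_core (ballCore_of_rayIdentity rayIdentity_of_total)` and
  ★ `wall02_cubeLimit`) — so brick (f2) (the value clause in jet-limit form) is NOT NEEDED: the values were already ★ in extension form since ED. 4∕5; and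
  **`archCentralLimitExists_of_liePhiJetBounds`** — (A6-lim) ★ `ArchCentralLimitExists` at every frame from `hball` (★ `ArchCentralLimitExists.of_rankTwo`), the IN-stub of closer ED. 35 ∕ SdArch ED. 6.
What remains UPSTREAM is exactly `hball` = (d2) FILE 3b's `chamber_forall_norm_iteratedFDeriv_liePhi_bounded` (owner F0P3a-p05 (g15)).
HONEST LABEL: HC_CM is proved only modulo the printed citations until rung 0 closes; this file is plumbing over ★ bricks and pays nothing by itself until `hball` is ★.

## References
* [WarnerHASSLG2] G. Warner, *Harmonic Analysis on Semi-Simple Lie Groups II*, Grundlehren 189 (1972), Thm. 8.4.3.1, §8.5.1 Thm. 8.5.1.1 («`ᶠF_f` is `C^∞` on the closure of each component»).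
* [Whitney1934] H. Whitney, *Analytic extensions of differentiable functions defined in closed sets*, Trans. AMS 36 (1934), Thm. I.
* [Rogawski1990] J. D. Rogawski, *Automorphic Representations of Unitary Groups in Three Variables*, Ann. of Math. Stud. 123 (1990), §8.4 pp. 126–127.
* [HarishChandra1975HARRG1] Harish-Chandra, *Harmonic analysis on real reductive groups I*, J. Funct. Anal. 19 (1975), §17 Lemma 17.5.
-/

set_option autoImplicit false

noncomputable section

open Filter Topology Set Function Metric MeasureTheory Measure Complex
open scoped ContDiff NNReal

namespace Literature.NumberTheory.Rogawski1990

open Literature.Analysis.Calculus Literature.NumberTheory.Automorphic Literature.NumberTheory.Automorphic.UnitaryGroup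
open Literature.Geometry.ComplexHyperbolic Literature.Geometry.ComplexHyperbolic.BallModel
open NumberField NumberField.InfinitePlace
open scoped Matrix MatrixGroups Matrix.Norms.Operator

/-! ## §1 (A6) at an e-pattern frame from bounded jets of `liePhi` of all orders on every chamber -/

section CornerRegularity

variable (L : Type) [Field L] (α : Fin 3 → L) (w : {w : InfinitePlace L // IsComplex w})

/-- In the sup norm of `ℝ³`, `θ ∈ B(0,r)` gives `|θ_k| ≤ r`. [cite: Rogawski1990, §8.4 p. 126] -/
theorem abs_apply_le_of_mem_ball_zero {θ : Fin 3 → ℝ} {r : ℝ} (hθ : θ ∈ ball (0 : Fin 3 → ℝ) r) (k : Fin 3) : |θ k| ≤ r := by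
  have h := norm_le_pi_norm θ k
  rw [Real.norm_eq_abs] at h
  exact h.trans (mem_ball_zero_iff.1 hθ).le

/-- The chamber piece `C_σ ∩ B(0,1∕4)` is nonempty (the point `θ(σ j) = j∕16`). [cite: Rogawski1990, §8.4 p. 126] -/
theorem chamber_inter_ball_quarter_nonempty (σ : Equiv.Perm (Fin 3)) :
    ({θ : Fin 3 → ℝ | θ (σ 0) < θ (σ 1) ∧ θ (σ 1) < θ (σ 2)} ∩ ball (0 : Fin 3 → ℝ) (1 / 4)).Nonempty := by
  refine ⟨fun k => ((σ.symm k : Fin 3) : ℕ) / 16, ⟨?_, ?_⟩, ?_⟩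
  · simp only [Equiv.symm_apply_apply, Fin.val_zero, Fin.val_one, CharP.cast_eq_zero, zero_div, Nat.cast_one]
    norm_num
  · simp only [Equiv.symm_apply_apply, Fin.val_one, Nat.cast_one, Fin.val_two, Nat.cast_ofNat]
    norm_num
  · rw [mem_ball_zero_iff, pi_norm_lt_iff (by norm_num : (0:ℝ) < 1 / 4)]
    intro k
    rw [Real.norm_eq_abs, abs_of_nonneg (by positivity)]
    have hk : ((σ.symm k : Fin 3) : ℕ) ≤ 2 := Nat.lt_succ_iff.1 (σ.symm k).isLt
    have hk' : (((σ.symm k : Fin 3) : ℕ) : ℝ) ≤ 2 := by exact_mod_cast hk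
    linarith

/-- **(A6) FROM THE JET BOUNDS (e-pattern frame).**  At a frame with `re σ_wα₀, re σ_wα₁ > 0 > re σ_wα₂`: IF for every Haar right-invariant `μ` on `U(2,1)`, every `f ∈ C_c^∞(M₃(ℂ))`, every
chamber `σ` and every `n` the jets `Dⁿ(liePhi μ f)` are bounded on `C_σ ∩ B(0,1∕4)` (Harish-Chandra, Warner Thm. 8.4.3.1 — brick (d2)'s output VERBATIM), THEN Harish-Chandra's corner
regularity ★ `ArchCentralLimitCornerRegularity L α w` holds: `F_Θ∘chart_ζ|_{C_σ}` has a `C³` extension to a neighbourhood of `0` (★ (f1) transfer `F_Θ∘chart = u·liePhi`, ★ closure lemma,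
★ Whitney on the closed convex `closure(C_σ ∩ B(0,1∕4))`). [cite: WarnerHASSLG2, Thm. 8.4.3.1; §8.5.1 Thm. 8.5.1.1] [cite: Whitney1934, Thm. I] [cite: HarishChandra1975HARRG1, §17 Lemma 17.5] -/
theorem archCentralLimitCornerRegularity_of_liePhiJetBounds
    (h0 : 0 < (w.1.embedding (α 0)).re) (h1 : 0 < (w.1.embedding (α 1)).re) (h2 : (w.1.embedding (α 2)).re < 0)
    (hball : ∀ (μ : Measure U21) [μ.IsHaarMeasure] [μ.IsMulRightInvariant] (f : Matrix (Fin 3) (Fin 3) ℂ → ℂ), ContDiff ℝ ∞ f → HasCompactSupport f →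
      ∀ (σ : Equiv.Perm (Fin 3)) (n : ℕ), ∃ M : ℝ, ∀ θ ∈ {θ : Fin 3 → ℝ | θ (σ 0) < θ (σ 1) ∧ θ (σ 1) < θ (σ 2)} ∩ ball (0 : Fin 3 → ℝ) (1 / 4), ‖iteratedFDeriv ℝ n (liePhi μ f) θ‖ ≤ M) :
    ArchCentralLimitCornerRegularity L α w := by
  intro _ _ hα hreal ν _ _ Θ hΘ hΘc ζ σ
  -- §a frame, test function, Weyl cofactor
  obtain ⟨e, f, hf, hfc, hint⟩ := exists_frame_testFunction_orbital_eq_lieOrbital L α w hreal h0 h1 h2 ν Θ hΘ hΘc ζ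
  haveI : (ν.map e).IsHaarMeasure := isHaarMeasure_map_archLocalEquiv L α w e ν
  haveI : (ν.map e).IsMulRightInvariant := isMulRightInvariant_map_archLocalEquiv L α w e ν
  obtain ⟨u, hu, -, hfac⟩ := exists_smooth_rhoWeylDelta_angleChart_eq_mul_rootProduct
  -- §b the convex open chamber piece `s`, `liePhi` smooth with bounded jets of all orders on it
  set s : Set (Fin 3 → ℝ) := {θ : Fin 3 → ℝ | θ (σ 0) < θ (σ 1) ∧ θ (σ 1) < θ (σ 2)} ∩ ball (0 : Fin 3 → ℝ) (1 / 4) with hsdef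
  have hs : IsOpen s := (isOpen_chamber σ).inter isOpen_ball
  have hsc : Convex ℝ s := (convex_chamber σ).inter (convex_ball _ _)
  have hφ : ContDiffOn ℝ ∞ (liePhi (ν.map e) f) s := by
    intro θ hθ
    have hinj := injective_of_mem_chamber hθ.1
    exact (contDiffAt_liePhi (ν.map e) hf hfc θ (hinj.ne (by decide)) (hinj.ne (by decide))).contDiffWithinAt
  obtain ⟨Φ, hΦ, hΦeq, -⟩ := exists_contDiffOn_closure_of_bounded_iteratedFDeriv hs hsc hφ (fun n => hball (ν.map e) f hf hfc σ n)
  -- §c Whitney on `closure s` at the corner `0`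
  have h0cl : (0 : Fin 3 → ℝ) ∈ closure s := by
    have h0 : (0 : Fin 3 → ℝ) ∈ closure {θ : Fin 3 → ℝ | θ (σ 0) < θ (σ 1) ∧ θ (σ 1) < θ (σ 2)} ∩ ball (0 : Fin 3 → ℝ) (1 / 4) :=
      ⟨mem_closure_chamber_of_le σ le_rfl le_rfl, mem_ball_self (by norm_num)⟩
    exact isOpen_ball.closure_inter h0
  have hint' : (interior (closure s)).Nonempty :=
    (chamber_inter_ball_quarter_nonempty σ).mono ((hs.subset_interior_iff).2 subset_closure)
  obtain ⟨O', hO', h0O', -, g, hg, hgeq⟩ := WhitneyExtensionConvex_holds.exists_contDiffOn_extension isClosed_closure hsc.closure hint' isOpen_univ (mem_univ _) h0cl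
    (f := Φ) (hΦ.mono Set.inter_subset_right)
  -- §d the extension `H = u · g` on `U = O' ∩ B(0,1∕4)`
  refine ⟨O' ∩ ball (0 : Fin 3 → ℝ) (1 / 4), fun θ => u θ * g θ, hO'.inter isOpen_ball, ⟨h0O', mem_ball_self (by norm_num)⟩,
    ((hu.contDiffOn.mul (hg.mono Set.inter_subset_left)).of_le (WithTop.coe_le_coe.mpr le_top)), fun θ hθ hθC => ?_⟩
  have hθs : θ ∈ s := ⟨hθC, hθ.2⟩
  show u θ * g θ = _
  rw [hfac ζ θ, hint θ (fun k => abs_apply_le_of_mem_ball_zero hθ.2 k), hgeq ⟨hθ.1, subset_closure hθs⟩, hΦeq hθs, liePhi_def, Complex.real_smul, mul_assoc]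

end CornerRegularity

/-! ## §2 The letter and (A6-lim) at every frame from the jet bounds alone (SdArch ED. 5's body with `stub_A6 ↦ §1`) -/

/-- **THE LETTER `(L_{U(2,1)})` AT EVERY FRAME FROM HARISH-CHANDRA'S JET BOUNDS ALONE**: the «SdArch» ED. 5 derivation VERBATIM with `stub_A6` replaced by §1 — e-pattern frames by
★ `of_cornerRegularity_of_wallValues_min` (corner regularity §1; D-chamber values ★ `cornerValue_min_of_core` over the in-house W6-core ★ `ballCore_of_rayIdentity rayIdentity_of_total`;
S-chamber third jets ★ `wall02_cubeLimit`), every frame by ★ `archCentralLimitFormulaRankTwo_of_ppm`.  Brick (f2) of design v2 is thereby unnecessary.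
[cite: Rogawski1990, §8.4 pp. 126–127] [cite: WarnerHASSLG2, Thm. 8.4.3.1; §8.5.1] -/
theorem archCentralLimitFormulaRankTwo_of_liePhiJetBounds
    (hball : ∀ (μ : Measure U21) [μ.IsHaarMeasure] [μ.IsMulRightInvariant] (f : Matrix (Fin 3) (Fin 3) ℂ → ℂ), ContDiff ℝ ∞ f → HasCompactSupport f →
      ∀ (σ : Equiv.Perm (Fin 3)) (n : ℕ), ∃ M : ℝ, ∀ θ ∈ {θ : Fin 3 → ℝ | θ (σ 0) < θ (σ 1) ∧ θ (σ 1) < θ (σ 2)} ∩ ball (0 : Fin 3 → ℝ) (1 / 4), ‖iteratedFDeriv ℝ n (liePhi μ f) θ‖ ≤ M) :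
    ∀ (L : Type) [Field L] (α : Fin 3 → L) (w : {w : InfinitePlace L // IsComplex w}), ArchCentralLimitFormulaRankTwo L α w :=
  fun L _ α w => archCentralLimitFormulaRankTwo_of_ppm (fun L₀ _ _ _ α₀ w₀ h0 h1 h2 =>
    ArchCentralLimitFormulaRankTwo.of_cornerRegularity_of_wallValues_min (mul_neg_of_pos_of_neg h0 h2)
      (archCentralLimitCornerRegularity_of_liePhiJetBounds L₀ α₀ w₀ h0 h1 h2 hball)
      (cornerValue_min_of_core L₀ α₀ w₀ h0 h1 h2 (ballCore_of_rayIdentity rayIdentity_of_total))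
      (wall02_cubeLimit L₀ α₀ w₀ (mul_neg_of_pos_of_neg h0 h2))) L α w

/-- **(A6-lim) AT EVERY FRAME FROM THE JET BOUNDS ALONE**: ★ `ArchCentralLimitExists L α w` (the IN-stub `stub_A6lim` of closer ED. 35 ∕ SdArch ED. 6) from `hball`, by ★ `ArchCentralLimitExists.of_rankTwo`.
[cite: Rogawski1990, §8.4 p. 126 L13] [cite: HarishChandra1975HARRG1, §17 Lemma 17.5] -/
theorem archCentralLimitExists_of_liePhiJetBounds
    (hball : ∀ (μ : Measure U21) [μ.IsHaarMeasure] [μ.IsMulRightInvariant] (f : Matrix (Fin 3) (Fin 3) ℂ → ℂ), ContDiff ℝ ∞ f → HasCompactSupport f →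
      ∀ (σ : Equiv.Perm (Fin 3)) (n : ℕ), ∃ M : ℝ, ∀ θ ∈ {θ : Fin 3 → ℝ | θ (σ 0) < θ (σ 1) ∧ θ (σ 1) < θ (σ 2)} ∩ ball (0 : Fin 3 → ℝ) (1 / 4), ‖iteratedFDeriv ℝ n (liePhi μ f) θ‖ ≤ M) :
    ∀ (L : Type) [Field L] (α : Fin 3 → L) (w : {w : InfinitePlace L // IsComplex w}), ArchCentralLimitExists L α w :=
  fun L _ α w => ArchCentralLimitExists.of_rankTwo (archCentralLimitFormulaRankTwo_of_liePhiJetBounds hball L α w)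

end Literature.NumberTheory.Rogawski1990

end
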